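import Summits.Ventures.LatticeQCDFlow.Scaling.LazyCollectorFloor
import Summits.Ventures.LatticeQCDFlow.Scaling.HubCollectorLaw

/-!
HONEST FRAMING: exact (Metropolis-corrected) sampling algorithms for lattice gauge theory; figures
of merit are autocorrelation/cost numbers at stated couplings and volumes; no continuum-physics
claim.

# SingleSiteCollectorLaw — RANDOM-SCAN SINGLE-SITE DYNAMICS ON `|L|` SITES WITH A LARGE LOCAL ALPHABET NEED
# `(|L| − 1)·log(|L|/4)` UPDATES (`log(|L|/4)` SWEEPS) FROM A WORST START, WHATEVER THE INTERACTION, THE LOCAL RULE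
# (HEAT BATH, METROPOLIS, …), THE SITE-SELECTION LAW AND THE TARGET: `t_mix(ε) ≥ (|L| − 1)·log(|L|·η)` WHENEVER
# `π{∃ k, z_k = x_k} ≤ δ` AND `ε < 1 − η − δ`, AND SUCH A START EXISTS FOR EVERY `π` AS SOON AS `|S| ≥ 4|L|`
# (lean-2 GEN-24, ours)

Venture-side (OURS).  Cell `lqcd-flow` (pub-lqcd), unit `pub-lqcd-lean-2-g24`, 2026-08-27.  Chapter L (the coupon-collector
law from a cold start), file 9 — the volume-scaling edge of the chapter.  A RANDOM-SCAN SINGLE-SITE DYNAMICS on the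
configurations `L → S` (sites `L`, local alphabet `S`): `P = Σ_k w_k·K_k`, the site `k` drawn with probability `w_k` and
resampled by ANY transition matrix `K_k` that changes only coordinate `k` (`K_k(y,z) ≠ 0 ⇒ z_j = y_j` for `j ≠ k`; the
rule may depend on the whole configuration: Glauber / heat-bath / Metropolis single-link updates of an interacting
system are included), stationary for an arbitrary probability vector `π`.  This is the mixture of local moves of
`Scaling/UntouchedReplicas` with `ι = L`, `τ k = {k}`; every set of sites is independent; the touch rate of `k` is `w_k`
and the rates sum to `1`, so the average form of the collector bound (`Scaling/LazyCollectorFloor`) applies with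
`Θ = 1`, `|T| = |L|`.

## What is proved

* §1 `singleSite_touchRate` (`θ_k = w_k`), `singleSite_independent`, `singleSite_touchRate_sum`.
* §2 **`singleSite_worstTvDist_ge`** — `d(n) ≥ 1 − 1/Σ_{k∈T}(1−w_k)ⁿ − π{z : ∃ k ∈ T, z_k = x_k}` for every `T`, `x`, `n`
  and every probability vector `π`; **`singleSite_mixingTime_ge` (THE VOLUME LAW)** — `|L| ≥ 2`, `π` stationary,
  `π{∃ k, z_k = x_k} ≤ δ`, `0 < η`, `ε < 1 − η − δ`, the dynamics `ε`-close at some time: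
  **`t_mix(ε) ≥ (|L| − 1)·log(|L|·η)`**; `singleSite_mixingTime_ge_quarter`.
* §3 **`marginal_isProbability`**, **`exists_rare_start_of_card`** — for EVERY probability vector `π` on `L → S` with
  `4|L| ≤ |S|` there is a configuration `x` with `π{∃ k, z_k = x_k} ≤ 1/4` (each one-site marginal has an atom of mass
  `≤ 1/|S|`; union bound); **`singleSite_mixingTime_ge_of_card` (THE HEADLINE)** — `|L| ≥ 2`, `|S| ≥ 4|L|`, any `π`,
  any `π`-stationary random-scan single-site dynamics `1/4`-close at some time: **`t_mix(1/4) ≥ (|L| − 1)·log(|L|/4)`**;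
  `singleSite_sweeps_ge` — in sweeps (`|L|` updates): **`t_mix(1/4)/|L| ≥ (1 − 1/|L|)·log(|L|/4)`**.

Reading (no numerics implied): a local-update sampler of a lattice system with `V` links and a fine local alphabet
cannot reach equilibrium from a worst start in fewer than `≈ V·log V` single-link updates, i.e. `log V` sweeps, for ANY
interaction and ANY exact local rule — the volume enters the cold-start cost at least as `V log V` before any critical
slowing down is counted.  This is the elementary large-alphabet case of the general `Ω(n log n)` bound for single-site
dynamics (Hayes–Sinclair, bounded-degree spin systems with any alphabet, not typed here); for `|S| < 4|L|` (e.g. Ising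
spins) the initial values are not rare and the present argument gives nothing.  NOT CLAIMED: systematic (deterministic)
scans; block or cluster updates; continuous alphabets; anything measured.  Literature grade (cell rule): KNOWN
MECHANISM, NEW TYPING in this generality; nothing cited as a fact; no new bib keys.
-/

noncomputable section

open Finset Function
open Literature.Probability.MarkovChains

namespace Summit.Ventures.LatticeQCDFlow.Scaling

variable {S L : Type*} [Fintype S] [DecidableEq S] [Fintype L] [DecidableEq L]
  {w : L → ℝ} {Ksite : L → (L → S) → (L → S) → ℝ} {P : (L → S) → (L → S) → ℝ}

/-! ## §1 The single-site schedule -/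

omit [Fintype S] [DecidableEq S] in
/-- **The touch rate of site `k` is `w_k`.** [ours] -/
theorem singleSite_touchRate (k : L) : ∑ j ∈ univ.filter (fun j : L => k ∈ ({j} : Finset L)), w j = w k := by
  have hf : univ.filter (fun j : L => k ∈ ({j} : Finset L)) = {k} := by
    ext j; simp only [Finset.mem_filter, Finset.mem_univ, true_and, Finset.mem_singleton]; exact eq_comm
  rw [hf, Finset.sum_singleton]

omit [Fintype S] [DecidableEq S] [Fintype L] [DecidableEq L] in
/-- Every set of sites is independent for a single-site schedule. [ours] -/
theorem singleSite_independent (T : Finset L) :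
    ∀ j : L, ∀ k ∈ T, ∀ l ∈ T, k ≠ l → ¬(k ∈ ({j} : Finset L) ∧ l ∈ ({j} : Finset L)) := by
  intro j k _ l _ hkl ⟨hk, hl⟩
  rw [Finset.mem_singleton] at hk hl
  exact hkl (hk.trans hl.symm)

omit [Fintype S] [DecidableEq S] in
/-- The touch rates over all sites sum to `Σ w = 1`. [ours] -/
theorem singleSite_touchRate_sum (hw1 : ∑ k, w k = 1) :
    ∑ k, ∑ j ∈ univ.filter (fun j : L => k ∈ ({j} : Finset L)), w j = 1 := by
  rw [← hw1]; exact sum_congr rfl fun k _ => singleSite_touchRate k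

/-! ## §2 The volume law -/

/-- **`d(n) ≥ 1 − 1/Σ_{k∈T}(1−w_k)ⁿ − π{z : ∃ k ∈ T, z_k = x_k}`** for every random-scan single-site dynamics
(`w ≥ 0`, `Σ w = 1`, local transition matrices `K_k`), every probability vector `π`, every `T`, `x`, `n`. [ours] -/
theorem singleSite_worstTvDist_ge (hw0 : ∀ k, 0 ≤ w k) (hw1 : ∑ k, w k = 1) (hK : ∀ k, IsRowStochastic (Ksite k))
    (hloc : ∀ k y z j, j ≠ k → Ksite k y z ≠ 0 → z j = y j) (hP : ∀ y z, P y z = ∑ k, w k * Ksite k y z)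
    {π : (L → S) → ℝ} (hπ1 : ∑ z, π z = 1) (x : L → S) (T : Finset L) (n : ℕ)
    (hs : 0 < ∑ k ∈ T, (1 - w k) ^ n) :
    1 - 1 / (∑ k ∈ T, (1 - w k) ^ n) - ∑ z ∈ univ.filter (fun z : L → S => ∃ k ∈ T, z k = x k), π z
      ≤ worstTvDist P π n := by
  have hsum : ∑ k ∈ T, (1 - ∑ j ∈ univ.filter (fun j : L => k ∈ ({j} : Finset L)), w j) ^ n
      = ∑ k ∈ T, (1 - w k) ^ n := sum_congr rfl fun k _ => by rw [singleSite_touchRate (w := w) k]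
  have hs' := hs
  rw [← hsum] at hs'
  have hloc' : ∀ (k : L) (y z : L → S) (j : L), j ∉ ({k} : Finset L) → Ksite k y z ≠ 0 → z j = y j :=
    fun k y z j hj h => hloc k y z j (by rwa [Finset.mem_singleton] at hj) h
  have h := worstTvDist_ge_collector (c := w) (Pm := Ksite) (τ := fun j : L => ({j} : Finset L)) (P := P) hw0 hw1 hK
    hloc' hP hπ1 x T (singleSite_independent T) n hs'
  rw [hsum] at h
  exact h

/-- **THE VOLUME LAW:** `|L| ≥ 2` sites, any site-selection law `w`, any local transition matrices `K_k`, any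
probability vector `π` stationary for `P = Σ_k w_k·K_k`, a configuration `x` with `π{∃ k, z_k = x_k} ≤ δ`, `0 < η`,
`ε < 1 − η − δ`, the dynamics `ε`-close to `π` at some time: **`t_mix(ε) ≥ (|L| − 1)·log(|L|·η)`**. [ours] -/
theorem singleSite_mixingTime_ge (hL : 2 ≤ Fintype.card L) (hw0 : ∀ k, 0 ≤ w k) (hw1 : ∑ k, w k = 1)
    (hK : ∀ k, IsRowStochastic (Ksite k)) (hloc : ∀ k y z j, j ≠ k → Ksite k y z ≠ 0 → z j = y j)
    (hP : ∀ y z, P y z = ∑ k, w k * Ksite k y z) {π : (L → S) → ℝ} (hπ1 : ∑ z, π z = 1) (hst : IsStationary π P)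
    (x : L → S) {η δ ε : ℝ} (hη : 0 < η)
    (hδ : ∑ z ∈ univ.filter (fun z : L → S => ∃ k ∈ (univ : Finset L), z k = x k), π z ≤ δ) (hgap : ε < 1 - η - δ)
    (hmix : ∃ t₀, worstTvDist P π t₀ ≤ ε) :
    ((Fintype.card L : ℝ) - 1) * Real.log (Fintype.card L * η) ≤ (mixingTime P π ε : ℝ) := by
  set n := mixingTime P π ε with hn_def
  by_contra h
  push Not at h
  have hLpos : 0 < Fintype.card L := by omega
  have hne : (univ : Finset L).Nonempty := Finset.univ_nonempty_iff.mpr (Fintype.card_pos_iff.mp hLpos)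
  have hcard : ((univ : Finset L).card : ℝ) = Fintype.card L := by rw [card_univ]
  have hw1' : ∀ k ∈ (univ : Finset L), w k ≤ 1 := fun k _ => by
    rw [← hw1]; exact Finset.single_le_sum (fun j _ => hw0 j) (mem_univ _)
  have hΘT : (1 : ℝ) < (univ : Finset L).card := by
    rw [hcard]
    have h2 : (2 : ℝ) ≤ Fintype.card L := by exact_mod_cast hL
    linarith
  have hn' : (n : ℝ) ≤ ((((univ : Finset L).card : ℝ)) / 1 - 1) * Real.log (((univ : Finset L).card : ℝ) * η) := by
    rw [hcard, div_one]; exact h.le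
  have hsge := touchSum_ge_of_sum_le_log (univ : Finset L) hne w hw1' one_pos hΘT (le_of_eq hw1) hη hn'
  have hspos : 0 < ∑ k, (1 - w k) ^ n := lt_of_lt_of_le (by positivity) hsge
  have h1s : 1 / (∑ k, (1 - w k) ^ n) ≤ η := by rw [one_div_le hspos hη]; exact hsge
  have hProw := mixture_isRowStochastic (c := w) (Pm := Ksite) hw0 hw1 hK hP
  obtain ⟨t₀, ht₀⟩ := hmix
  have hd' := worstTvDist_le_of_mixingTime_le hProw hst ht₀ (le_refl n)
  have hfloor := singleSite_worstTvDist_ge hw0 hw1 hK hloc hP hπ1 x univ n hspos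
  linarith

/-- **THE QUARTER FORM: `t_mix(1/4) ≥ (|L| − 1)·log(|L|/4)`** from a start with `π{∃ k, z_k = x_k} ≤ 1/4`. [ours] -/
theorem singleSite_mixingTime_ge_quarter (hL : 2 ≤ Fintype.card L) (hw0 : ∀ k, 0 ≤ w k) (hw1 : ∑ k, w k = 1)
    (hK : ∀ k, IsRowStochastic (Ksite k)) (hloc : ∀ k y z j, j ≠ k → Ksite k y z ≠ 0 → z j = y j)
    (hP : ∀ y z, P y z = ∑ k, w k * Ksite k y z) {π : (L → S) → ℝ} (hπ1 : ∑ z, π z = 1) (hst : IsStationary π P)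
    (x : L → S) (hx : ∑ z ∈ univ.filter (fun z : L → S => ∃ k ∈ (univ : Finset L), z k = x k), π z ≤ 1 / 4)
    (hmix : ∃ t₀, worstTvDist P π t₀ ≤ 1 / 4) :
    ((Fintype.card L : ℝ) - 1) * Real.log (Fintype.card L / 4) ≤ (mixingTime P π (1 / 4) : ℝ) := by
  have h := singleSite_mixingTime_ge hL hw0 hw1 hK hloc hP hπ1 hst x (η := 1 / 4) (by norm_num) hx
    (by norm_num : (1 : ℝ) / 4 < 1 - 1 / 4 - 1 / 4) hmix
  rwa [mul_one_div] at h

/-! ## §3 Rare starts exist for every target on a large alphabet -/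

omit [DecidableEq S] in
/-- The one-site marginal of a probability vector on `L → S` is a probability vector on `S`. [ours] -/
theorem marginal_isProbability [DecidableEq S] {π : (L → S) → ℝ} (hπ1 : ∑ z, π z = 1) (k : L) :
    ∑ u : S, ∑ z ∈ univ.filter (fun z : L → S => z k = u), π z = 1 := by
  rw [← hπ1, ← Finset.sum_fiberwise univ (fun z : L → S => z k) π]

omit [DecidableEq S] in
/-- **RARE STARTS EXIST FOR EVERY TARGET: `π ≥ 0`, `Σ π = 1`, `4|L| ≤ |S|` ⇒ some `x` has `π{∃ k, z_k = x_k} ≤ 1/4`.**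
[ours] -/
theorem exists_rare_start_of_card [DecidableEq S] {π : (L → S) → ℝ} (hπ0 : ∀ z, 0 ≤ π z) (hπ1 : ∑ z, π z = 1)
    (hS : 4 * Fintype.card L ≤ Fintype.card S) :
    ∃ x : L → S, ∑ z ∈ univ.filter (fun z : L → S => ∃ k ∈ (univ : Finset L), z k = x k), π z ≤ 1 / 4 := by
  -- an atom of mass `≤ 1/|S|` of each one-site marginal
  choose u hu using fun k => exists_apply_le_inv_card (ν := fun v : S => ∑ z ∈ univ.filter (fun z : L → S => z k = v), π z)
    (marginal_isProbability hπ1 k)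
  refine ⟨u, ?_⟩
  have hcardS : (0 : ℝ) ≤ Fintype.card S := Nat.cast_nonneg _
  -- union bound over the sites
  have hunion : ∑ z ∈ univ.filter (fun z : L → S => ∃ k ∈ (univ : Finset L), z k = u k), π z
      ≤ ∑ k, ∑ z ∈ univ.filter (fun z : L → S => z k = u k), π z := by
    calc ∑ z ∈ univ.filter (fun z : L → S => ∃ k ∈ (univ : Finset L), z k = u k), π z
        = ∑ z, π z * (if ∃ k ∈ (univ : Finset L), z k = u k then (1 : ℝ) else 0) := by
          rw [Finset.sum_filter]; exact sum_congr rfl fun z _ => by split_ifs <;> simp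
      _ ≤ ∑ z, π z * ∑ k, (if z k = u k then (1 : ℝ) else 0) := by
          refine sum_le_sum fun z _ => mul_le_mul_of_nonneg_left ?_ (hπ0 z)
          split_ifs with h
          · obtain ⟨k, -, hzk⟩ := h
            exact le_trans (by rw [if_pos hzk])
              (Finset.single_le_sum (f := fun k => if z k = u k then (1 : ℝ) else 0)
                (fun k _ => by split_ifs <;> norm_num) (mem_univ k))
          · exact sum_nonneg fun k _ => by split_ifs <;> norm_num
      _ = ∑ k, ∑ z, π z * (if z k = u k then (1 : ℝ) else 0) := by simp_rw [mul_sum]; rw [sum_comm]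
      _ = ∑ k, ∑ z ∈ univ.filter (fun z : L → S => z k = u k), π z := by
          refine sum_congr rfl fun k _ => ?_
          rw [Finset.sum_filter]; exact sum_congr rfl fun z _ => by split_ifs <;> simp
  rcases Nat.eq_zero_or_pos (Fintype.card L) with hL0 | hLpos
  · -- no sites: the bad set is empty
    have : IsEmpty L := Fintype.card_eq_zero_iff.mp hL0
    have hempty : univ.filter (fun z : L → S => ∃ k ∈ (univ : Finset L), z k = u k) = ∅ :=
      Finset.filter_false_of_mem fun z _ => by simp
    rw [hempty, Finset.sum_empty]; norm_num
  · have hcardS' : (0 : ℝ) < Fintype.card S := by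
      have : 0 < Fintype.card S := by omega
      exact_mod_cast this
    have hS' : (4 : ℝ) * Fintype.card L ≤ Fintype.card S := by exact_mod_cast hS
    calc ∑ z ∈ univ.filter (fun z : L → S => ∃ k ∈ (univ : Finset L), z k = u k), π z
        ≤ ∑ k, ∑ z ∈ univ.filter (fun z : L → S => z k = u k), π z := hunion
      _ ≤ ∑ _k : L, (1 : ℝ) / Fintype.card S := sum_le_sum fun k _ => hu k
      _ = (Fintype.card L : ℝ) / Fintype.card S := by rw [sum_const, card_univ, nsmul_eq_mul]; field_simp
      _ ≤ 1 / 4 := by rw [div_le_iff₀ hcardS']; linarith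

/-- **THE HEADLINE: `|L| ≥ 2` sites, `|S| ≥ 4|L|`, ANY probability vector `π`, ANY `π`-stationary random-scan single-site
dynamics `1/4`-close at some time ⇒ `t_mix(1/4) ≥ (|L| − 1)·log(|L|/4)`.** [ours] -/
theorem singleSite_mixingTime_ge_of_card (hL : 2 ≤ Fintype.card L) (hS : 4 * Fintype.card L ≤ Fintype.card S)
    (hw0 : ∀ k, 0 ≤ w k) (hw1 : ∑ k, w k = 1) (hK : ∀ k, IsRowStochastic (Ksite k))
    (hloc : ∀ k y z j, j ≠ k → Ksite k y z ≠ 0 → z j = y j) (hP : ∀ y z, P y z = ∑ k, w k * Ksite k y z)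
    {π : (L → S) → ℝ} (hπ0 : ∀ z, 0 ≤ π z) (hπ1 : ∑ z, π z = 1) (hst : IsStationary π P)
    (hmix : ∃ t₀, worstTvDist P π t₀ ≤ 1 / 4) :
    ((Fintype.card L : ℝ) - 1) * Real.log (Fintype.card L / 4) ≤ (mixingTime P π (1 / 4) : ℝ) := by
  obtain ⟨x, hx⟩ := exists_rare_start_of_card hπ0 hπ1 hS
  exact singleSite_mixingTime_ge_quarter hL hw0 hw1 hK hloc hP hπ1 hst x hx hmix

/-- **IN SWEEPS:** under the same hypotheses, **`t_mix(1/4)/|L| ≥ (1 − 1/|L|)·log(|L|/4)`** — at least `log(|L|/4)`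
sweeps of `|L|` single-site updates, up to the factor `1 − 1/|L|`. [ours] -/
theorem singleSite_sweeps_ge (hL : 2 ≤ Fintype.card L) (hS : 4 * Fintype.card L ≤ Fintype.card S)
    (hw0 : ∀ k, 0 ≤ w k) (hw1 : ∑ k, w k = 1) (hK : ∀ k, IsRowStochastic (Ksite k))
    (hloc : ∀ k y z j, j ≠ k → Ksite k y z ≠ 0 → z j = y j) (hP : ∀ y z, P y z = ∑ k, w k * Ksite k y z)
    {π : (L → S) → ℝ} (hπ0 : ∀ z, 0 ≤ π z) (hπ1 : ∑ z, π z = 1) (hst : IsStationary π P)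
    (hmix : ∃ t₀, worstTvDist P π t₀ ≤ 1 / 4) :
    (1 - 1 / (Fintype.card L : ℝ)) * Real.log (Fintype.card L / 4) ≤ (mixingTime P π (1 / 4) : ℝ) / Fintype.card L := by
  have hLpos : (0 : ℝ) < Fintype.card L := by
    have : 0 < Fintype.card L := by omega
    exact_mod_cast this
  have h := singleSite_mixingTime_ge_of_card hL hS hw0 hw1 hK hloc hP hπ0 hπ1 hst hmix
  rw [le_div_iff₀ hLpos]
  have e : (1 - 1 / (Fintype.card L : ℝ)) * Real.log (Fintype.card L / 4) * Fintype.card L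
      = ((Fintype.card L : ℝ) - 1) * Real.log (Fintype.card L / 4) := by
    field_simp
  rw [e]; exact h

end Summit.Ventures.LatticeQCDFlow.Scaling

end
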